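import Summits.BirchSwinnertonDyer.BirchSwinnertonDyer.Theorems.KimAtThreeFineKatoLevelCompatFactor
import Literature.NumberTheory.GaloisRepresentations.ContinuousH1RestrictScalars
import HarnessLib

/-!
# Per-factor COMPAT with `Λ_w := exp*_w ∘ loc_w` DEFINED cocycle-free, and the canonical coefficient
# change `Ψ = π_{j+1,*}` on level cohomology (crux `KatoKuriharaPortThreeShared`,
# stmt-BirchSwinnertonDyer-19560, stub `stub_definedKatoPackage` = hK; cell `bsd-addord`, seat w2-acc5 gen 4;
# route W2 `KimAtThreeKolyvagin`; `--supports 19560`, helper)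

HONEST FRAMING. TOOL theorems only (no definition, no named fact, no `sorry`); closes nothing; nothing
is booked; BSD is not proved by any of this.  `KimAtThreeFineKatoLevelCompatFactor` (p496279) proves the
per-factor COMPAT clause of the 19560 LEAD's package from two displayed properties of the abstract data,
(DEF_w) «`L_F y = φ_F(loc_w y)` on cocycles» and (RES_w); and hK binds the coefficient change
`Ψ : H¹(U, T_pE) → H¹(U, E[p^j·p])` only through its cocycle description `hΨ` — both because level
cohomology `H1 (tateRep W p) U` is `ℤ_[p]`-linear while the local / torsion cohomology is `ℤ`-linear.
With the restriction of scalars `ContinuousRep.H1toInt` (`Literature/…/ContinuousH1RestrictScalars`,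
p496173) both seams close:

* `factorDef_of_H1toInt` — **the composite `L_F := φ_F ∘ loc_w^{ℤ} ∘ H1toInt` satisfies (DEF_w)** for EVERY
  additive `φ_F` (so Kato-v2's `Λ := Ψ⁻¹ ∘ (exp*_w ∘ loc_w ∘ H1toInt)_w` meets `hdef` by name);
* `exists_mem_sub_eq_zsmul_of_H1toInt` — **per-factor COMPAT with NO definitional hypothesis on `Λ`**:
  from (RES_w) alone, `∃ μ ∈ M, e h − φ_F(loc_w (H1toInt y)) = p^{j+1}·μ`;
* `levelTorsionMap_H1toInt_oneCocycleClass` — **the canonical `Ψ := π_{j+1,*} ∘ H1toInt` on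
  `H1 (tateRep W p) U` satisfies hK's binder `hΨ`** (`Ψ [φ'] = [ψ]` whenever `ψ = π_{j+1} ∘ φ'` pointwise).

`loc_w^{ℤ}` is `LevelFieldLocalization.locTower` for the `ℤ`-linear Tate module `(tateRep W p).toIntRep`,
whose level / tower objects are `((tateRep W p).level U).toIntRep` and
`(tateLocalRep W p v).restrict res_{F/ℚ_v}` definitionally.  Every `p`, `v`, `j`, `(k, r)`, `F`.

References: K. Kato, Astérisque 295 (2004) §9.4 [Kato2004Asterisque]; C.-H. Kim, AJM 148 (2026) §3.4.1
[Kim2022StructureSelmer]; J.-P. Serre, *Galois Cohomology* (1997) I §2.2 [SerreGaloisCohomology1997].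
-/

noncomputable section

-- the cell's Theorems namespace `Summit.BirchSwinnertonDyer.BirchSwinnertonDyer.…` repeats the summit name by design (D-0017)
set_option linter.dupNamespace false

open scoped Classical NumberField ContRepresentation TensorProduct
open Field NumberField IsDedekindDomain
open WeierstrassCurve Literature.NumberTheory.EllipticCurves Literature.NumberTheory.GaloisRepresentations
  Literature.NumberTheory.GaloisRepresentations.DiscreteGaloisModule
  Literature.NumberTheory.EllipticCurves.Kato2004.EulerSystemValues
open Summit.BirchSwinnertonDyer.Rank1Residual.GaloisImage
open Summit.BirchSwinnertonDyer.BirchSwinnertonDyer.Theorems.KimAtThreeFineKatoLevelExactness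
open Summit.BirchSwinnertonDyer.BirchSwinnertonDyer.Theorems.KimAtThreeFineKatoLevelCompat
open Summit.BirchSwinnertonDyer.BirchSwinnertonDyer.Theorems.KimAtThreeFineKatoLevelCompatFactor

namespace Summit.BirchSwinnertonDyer.BirchSwinnertonDyer.Theorems.KimAtThreeFineKatoLevelCompatDef

/-! ### Generic glue: restriction of scalars on LEVEL cocycles -/

section Generic

variable {G : Type} [Group G] [TopologicalSpace G] [IsTopologicalGroup G]
  {A : Type} [CommRing A] [TopologicalSpace A]
  {M : Type} [AddCommGroup M] [Module A M] [TopologicalSpace M] [IsTopologicalAddGroup M]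
  [ContinuousSMul A M] (ρ : ContinuousRep G A M) (U : Subgroup G)

omit [IsTopologicalGroup G] in
/-- A level cocycle `f : U → M` of the `A`-linear `ρ` IS a level cocycle of `ρ.toIntRep` (same function).
[cite: SerreGaloisCohomology1997, I §2.2] -/
theorem exists_level_intCocycle (f : contOneCocycles (subgroupRep ρ.toTopRep U)) :
    ∃ f' : contOneCocycles (subgroupRep ρ.toIntRep.toTopRep U), ∀ g, f'.1 g = f.1 g :=
  ⟨⟨f.1, fun g h => f.2 g h⟩, fun _ => rfl⟩

/-- `H1toInt` on LEVEL classes, with the `ℤ`-class read over `subgroupRep ρ.toIntRep.toTopRep U` (the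
source of `LevelFieldLocalization.locTower`): `H1toInt [f] = [f']` for `f' = f` pointwise.
[cite: SerreGaloisCohomology1997, I §2.2] -/
theorem H1toInt_level_oneCocycleClass (f : contOneCocycles (subgroupRep ρ.toTopRep U))
    (f' : contOneCocycles (subgroupRep ρ.toIntRep.toTopRep U)) (hf : ∀ g, f'.1 g = f.1 g) :
    (ρ.level U).H1toInt (oneCocycleClass (subgroupRep ρ.toTopRep U) f) =
      (show (ρ.level U).toIntRep.cohomology 1 from
        oneCocycleClass (subgroupRep ρ.toIntRep.toTopRep U) f') :=
  (ContinuousRep.H1toInt_oneCocycleClass (ρ.level U) f).trans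
    (congrArg _ (Subtype.ext (ContinuousMap.ext fun g => (hf g).symm)))

end Generic

variable (W : WeierstrassCurve ℚ) [W.IsElliptic] (p : ℕ) [hp : Fact p.Prime]
  [ContinuousSMul ℤ_[p] (W.tateModule p)] (j k : ℕ) (r : Finset (HeightOneSpectrum (𝓞 ℚ)))
  (v : HeightOneSpectrum (𝓞 ℚ)) (F : Type) [Field F] [Algebra (Place.Completion (Sum.inr v)) F]

/-- **Restriction of scalars then tower localisation, on cocycles**: for a level cocycle `φ' : U → T_pE`
(`ℤ_[p]`-currency), `loc_w^{ℤ}(H1toInt [φ']) = [σ ↦ φ'(res(res σ))]` in `H¹(Γ_F, T_pE)` (tower action,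
`ℤ`-currency). [cite: SerreGaloisCohomology1997, I §2.2 and I §2.4] -/
theorem locTower_H1toInt_oneCocycleClass
    (hU : ∀ σ, absGaloisRestrictTower ℚ (Place.Completion (Sum.inr v)) F σ ∈ cycSubgroup p k r)
    (φ' : contOneCocycles (subgroupRep (tateRep W p).toTopRep (cycSubgroup p k r)))
    (ψT : contOneCocycles ((tateLocalRep W p (Sum.inr v)).restrict
      (absGaloisRestrict (Place.Completion (Sum.inr v)) F)).toTopRep)
    (hψT : ∀ σ, ψT.1 σ = φ'.1 ⟨absGaloisRestrictTower ℚ (Place.Completion (Sum.inr v)) F σ, hU σ⟩) :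
    locTower ℚ (Place.Completion (Sum.inr v)) F (tateRep W p).toIntRep.toTopRep (cycSubgroup p k r) hU 1
        (((tateRep W p).level (cycSubgroup p k r)).H1toInt
          (oneCocycleClass (subgroupRep (tateRep W p).toTopRep (cycSubgroup p k r)) φ')) =
      (show ((tateLocalRep W p (Sum.inr v)).restrict
          (absGaloisRestrict (Place.Completion (Sum.inr v)) F)).cohomology 1 from oneCocycleClass _ ψT) := by
  obtain ⟨f', hf'⟩ := exists_level_intCocycle (tateRep W p) (cycSubgroup p k r) φ'
  refine (congrArg (locTower ℚ (Place.Completion (Sum.inr v)) F (tateRep W p).toIntRep.toTopRep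
    (cycSubgroup p k r) hU 1) (H1toInt_level_oneCocycleClass (tateRep W p) _ φ' f' hf')).trans ?_
  refine (locTower_oneCocycleClass ℚ (Place.Completion (Sum.inr v)) F (tateRep W p).toIntRep.toTopRep
    (cycSubgroup p k r) hU f').trans ?_
  refine congrArg _ (Subtype.ext (ContinuousMap.ext fun σ => ?_))
  rw [locTower_pullback_apply, hf', hψT]
  rfl

/-- **`L_F := φ_F ∘ loc_w^{ℤ} ∘ H1toInt` satisfies (DEF_w)** of `KimAtThreeFineKatoLevelCompatFactor` for
every additive `φ_F` on `H¹(Γ_F, T_pE)`: the `w`-component of a value datum DEFINED as `exp*_w ∘ loc_w`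
meets the displayed definitional clause by name. [cite: Kato2004Asterisque, §9.4 (exp* on the semi-local cohomology at p)] -/
theorem factorDef_of_H1toInt
    (hU : ∀ σ, absGaloisRestrictTower ℚ (Place.Completion (Sum.inr v)) F σ ∈ cycSubgroup p k r)
    {V : Type} [AddCommGroup V]
    (φF : ((tateLocalRep W p (Sum.inr v)).restrict
      (absGaloisRestrict (Place.Completion (Sum.inr v)) F)).cohomology 1 →+ V)
    (y : H1 (tateRep W p) (cycSubgroup p k r))
    (φ' : contOneCocycles (subgroupRep (tateRep W p).toTopRep (cycSubgroup p k r)))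
    (hy : oneCocycleClass (subgroupRep (tateRep W p).toTopRep (cycSubgroup p k r)) φ' = y)
    (ψT : contOneCocycles ((tateLocalRep W p (Sum.inr v)).restrict
      (absGaloisRestrict (Place.Completion (Sum.inr v)) F)).toTopRep)
    (hψT : ∀ σ, ψT.1 σ = φ'.1 ⟨absGaloisRestrictTower ℚ (Place.Completion (Sum.inr v)) F σ, hU σ⟩) :
    φF (locTower ℚ (Place.Completion (Sum.inr v)) F (tateRep W p).toIntRep.toTopRep (cycSubgroup p k r)
        hU 1 (((tateRep W p).level (cycSubgroup p k r)).H1toInt y)) =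
      φF (oneCocycleClass _ ψT) := by
  subst hy
  exact congrArg φF (locTower_H1toInt_oneCocycleClass W p k r v F hU φ' ψT hψT)

/-- **Per-factor COMPAT with `Λ_w` DEFINED as `exp*_w ∘ loc_w` (no definitional hypothesis left).**  For
additive `φ_F : H¹(Γ_F, T_pE) → V` (tower action) and `e : H¹(ℚ_v, T_pE) → V` with (RES_w)
`φ_F(res_{F/ℚ_v} h) = e h`, and a lattice `M ⊇ range φ_F`: whenever `res_U κ₀ = Ψ′ y` (`Ψ′` computed on
cocycles by `π_{j+1}`) and `loc_v κ₀ = π_{j+1,*} h`,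
`∃ μ ∈ M, e h − φ_F(loc_w^{ℤ}(H1toInt y)) = p^{j+1} · μ`.
[cite: Kim2022StructureSelmer, §3.4.1 and the proof of Thm. 3.13 (arXiv v3 pp. 26–27)] -/
theorem exists_mem_sub_eq_zsmul_of_H1toInt
    (hU : ∀ σ, absGaloisRestrictTower ℚ (Place.Completion (Sum.inr v)) F σ ∈ cycSubgroup p k r)
    {V : Type} [AddCommGroup V]
    (φF : ((tateLocalRep W p (Sum.inr v)).restrict
      (absGaloisRestrict (Place.Completion (Sum.inr v)) F)).cohomology 1 →+ V)
    (e : (tateLocalRep W p (Sum.inr v)).cohomology 1 →+ V)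
    (M : AddSubgroup V) (hM : ∀ z, φF z ∈ M)
    (hres : ∀ h : (tateLocalRep W p (Sum.inr v)).cohomology 1,
      φF (ContinuousRep.cohomologyRes (tateLocalRep W p (Sum.inr v))
        (absGaloisRestrict (Place.Completion (Sum.inr v)) F) 1 h) = e h)
    (Ψ : H1 (tateRep W p) (cycSubgroup p k r) →+
        continuousCohomology 1 (subgroupRep
          (W.torsionGaloisModule ((p : ℤ) ^ j * (p : ℤ))).toTopRep (cycSubgroup p k r)))
    (hΨ : ∀ (φ' : contOneCocycles (subgroupRep (tateRep W p).toTopRep (cycSubgroup p k r)))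
        (ψ : contOneCocycles (subgroupRep
          (W.torsionGaloisModule ((p : ℤ) ^ j * (p : ℤ))).toTopRep (cycSubgroup p k r))),
        (∀ g, ((ψ.1 g : geomTorsion W ((p : ℤ) ^ j * (p : ℤ))) : geomPoints W) =
          TateModule.proj p (j + 1) (φ'.1 g)) →
        Ψ (oneCocycleClass _ φ') = oneCocycleClass _ ψ)
    (y : H1 (tateRep W p) (cycSubgroup p k r))
    (κ₀ : galoisCohomology (W.torsionGaloisModule ((p : ℤ) ^ j * (p : ℤ))) 1)
    (h : (tateLocalRep W p (Sum.inr v)).cohomology 1)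
    (hresκ : resSubgroup (W.torsionGaloisModule ((p : ℤ) ^ j * (p : ℤ))).toTopRep (cycSubgroup p k r) 1 κ₀ =
      Ψ y)
    (hloc : galoisCohomology.localization (W.torsionGaloisModule ((p : ℤ) ^ j * (p : ℤ))) (Sum.inr v) 1 κ₀ =
      tateLocalMap W p j (Sum.inr v) h) :
    ∃ μ ∈ M, e h - φF (locTower ℚ (Place.Completion (Sum.inr v)) F (tateRep W p).toIntRep.toTopRep
        (cycSubgroup p k r) hU 1 (((tateRep W p).level (cycSubgroup p k r)).H1toInt y)) =
      ((p : ℤ) ^ (j + 1)) • μ :=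
  exists_mem_sub_eq_zsmul_of_factorDef W p j k r v F hU φF
    (φF.comp (((locTower ℚ (Place.Completion (Sum.inr v)) F (tateRep W p).toIntRep.toTopRep
        (cycSubgroup p k r) hU 1).hom.toLinearMap.toAddMonoidHom).comp
      ((tateRep W p).level (cycSubgroup p k r)).H1toInt))
    e M hM (fun y φ' hy ψT hψT => factorDef_of_H1toInt W p k r v F hU φF y φ' hy ψT hψT) hres Ψ hΨ
    y κ₀ h hresκ hloc

/-- **The canonical coefficient change `Ψ := π_{j+1,*} ∘ H1toInt : H¹(U, T_pE) → H¹(U, E[p^j·p])` on LEVEL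
cohomology satisfies hK's binder `hΨ`**: `Ψ [φ'] = [ψ]` whenever `ψ = π_{j+1} ∘ φ'` pointwise (so the
`∀ Ψ, hΨ → …` clauses of `stub_definedKatoPackage` have a canonical instance, and by the uniqueness noted
in `KatoExpStarFiniteLevelAt`'s docstring every admissible `Ψ` equals it).
[cite: SerreGaloisCohomology1997, I §2.2] -/
theorem levelTorsionMap_H1toInt_oneCocycleClass (U : Subgroup (absoluteGaloisGroup ℚ))
    (φ' : contOneCocycles (subgroupRep (tateRep W p).toTopRep U))
    (ψ : contOneCocycles (subgroupRep (W.torsionGaloisModule ((p : ℤ) ^ j * (p : ℤ))).toTopRep U))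
    (hψ : ∀ g, ((ψ.1 g : geomTorsion W ((p : ℤ) ^ j * (p : ℤ))) : geomPoints W) =
      TateModule.proj p (j + 1) (φ'.1 g)) :
    ContinuousRep.cohomologyMap
        ((W.tateGaloisRep p (W.continuous_galoisRepTate_holds p)).toIntRep.restrict (subgroupSubtypeHom U))
        ((W.torsionGaloisModule ((p : ℤ) ^ j * (p : ℤ))).restrict (subgroupSubtypeHom U))
        (tateToTorsion W p j) (continuous_tateToTorsion W p j)
        (tateToTorsion_restrict_apply W p j (subgroupSubtypeHom U)) 1
        (((tateRep W p).level U).H1toInt (oneCocycleClass (subgroupRep (tateRep W p).toTopRep U) φ')) =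
      (show ((W.torsionGaloisModule ((p : ℤ) ^ j * (p : ℤ))).restrict (subgroupSubtypeHom U)).cohomology 1
        from oneCocycleClass (subgroupRep (W.torsionGaloisModule ((p : ℤ) ^ j * (p : ℤ))).toTopRep U) ψ) := by
  obtain ⟨f', hf'⟩ := exists_level_intCocycle (tateRep W p) U φ'
  refine (congrArg _ (H1toInt_level_oneCocycleClass (tateRep W p) U φ' f' hf')).trans ?_
  refine (cohomologyMap_tateToTorsion_oneCocycleClass W p j (subgroupSubtypeHom U) f').trans ?_
  refine congrArg _ (Subtype.ext (ContinuousMap.ext fun g => Subtype.ext ?_))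
  rw [pullback_tateToTorsion_apply, hf', coe_tateToTorsion_apply, hψ]

/-! ### Appendix (w2-acc5 gen 4, second pass): the (C3b) «local at `p`» clause for `Λ_w := exp*_w ∘ loc_w ∘ H1toInt` -/

section LocalAtP

variable {G : Type} [Group G] [TopologicalSpace G] [IsTopologicalGroup G]
  {A : Type} [CommRing A] [TopologicalSpace A]
  {M : Type} [AddCommGroup M] [Module A M] [TopologicalSpace M] [IsTopologicalAddGroup M]
  [ContinuousSMul A M] (ρ : ContinuousRep G A M)

/-- **`H1toInt` commutes with restriction between levels**: `H1toInt (res_{U ≤ U'} y) = res_{U ≤ U'} (H1toInt y)`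
(both are `[f|_U]` on a cocycle `f` of `y`). [cite: SerreGaloisCohomology1997, I §2.2 and I §2.4] -/
theorem H1toInt_resLe {U U' : Subgroup G} (h : U ≤ U')
    (y : continuousCohomology 1 (subgroupRep ρ.toTopRep U')) :
    (ρ.level U).H1toInt (resLe ρ.toTopRep h 1 y) =
      (show (ρ.level U).toIntRep.cohomology 1 from
        resLe ρ.toIntRep.toTopRep h 1
          (show continuousCohomology 1 (subgroupRep ρ.toIntRep.toTopRep U') from (ρ.level U').H1toInt y)) := by
  obtain ⟨f, rfl⟩ := oneCocycleClass_surjective (subgroupRep ρ.toTopRep U') y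
  obtain ⟨f', hf'⟩ := exists_level_intCocycle ρ U' f
  refine (congrArg _ (resLe_oneCocycleClass ρ.toTopRep h f)).trans ?_
  obtain ⟨g', hg'⟩ := exists_level_intCocycle ρ U (contOneCocycles.pullback
    (Literature.NumberTheory.EllipticCurves.subgroupInclusion h) (Y := subgroupRep ρ.toTopRep U)
    (TopRep.ofHom ⟨ContinuousLinearMap.id A M, fun _ => rfl⟩) f)
  refine (H1toInt_level_oneCocycleClass ρ U _ g' hg').trans ?_
  refine Eq.trans ?_ (congrArg (resLe ρ.toIntRep.toTopRep h 1)
    (H1toInt_level_oneCocycleClass ρ U' f f' hf')).symm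
  refine Eq.trans ?_ (resLe_oneCocycleClass ρ.toIntRep.toTopRep h f').symm
  refine congrArg (oneCocycleClass (subgroupRep ρ.toIntRep.toTopRep U))
    (Subtype.ext (ContinuousMap.ext fun x => ?_))
  rw [hg']
  exact (hf' _).symm

end LocalAtP

open scoped Pointwise in
/-- **(C3b) for `Λ_w := exp*_w ∘ loc_w ∘ H1toInt`**: a level class `y ∈ H¹(U, T_pE)` (`ℤ_[p]`-currency,
`U = cycSubgroup p k r`) that dies on every `U ⊓ MulAction.stabilizer Γ_ℚ 𝔓`, `𝔓 ∈ v.primesAbove` — the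
binder of `Kato2004.ZetaBody` (C3b) VERBATIM — has `loc_w^{ℤ}(H1toInt y) = 0` at every field `F ⊇ ℚ_v`
whose tower restriction lands in `U`; hence `φ_F(loc_w(H1toInt y)) = 0` for every additive `φ_F`, i.e. a
value datum DEFINED through `loc_w ∘ H1toInt` is «local at `p`».
[cite: Kato2004Asterisque, §9.4 (exp* is a map on the semi-local cohomology at p)] -/
theorem locTower_H1toInt_eq_zero_of_forall_primesAbove
    (hU : ∀ σ, absGaloisRestrictTower ℚ (Place.Completion (Sum.inr v)) F σ ∈ cycSubgroup p k r)
    (y : H1 (tateRep W p) (cycSubgroup p k r))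
    (hy : ∀ 𝔓 ∈ v.primesAbove, resLe (tateRep W p).toTopRep
      (inf_le_left : cycSubgroup p k r ⊓ MulAction.stabilizer (absoluteGaloisGroup ℚ) 𝔓 ≤
        cycSubgroup p k r) 1 y = 0) :
    locTower ℚ (Place.Completion (Sum.inr v)) F (tateRep W p).toIntRep.toTopRep (cycSubgroup p k r) hU 1
        (((tateRep W p).level (cycSubgroup p k r)).H1toInt y) = 0 := by
  have hrange : (adicCompletionPrime ℚ v).decompositionSubgroup (absoluteGaloisGroup ℚ) =
      (absGaloisRestrict ℚ (Place.Completion (Sum.inr v))).toMonoidHom.range :=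
    decompositionSubgroup_adicCompletionPrime_eq_range ℚ v
  have hst : ∀ σ, absGaloisRestrictTower ℚ (Place.Completion (Sum.inr v)) F σ ∈
      cycSubgroup p k r ⊓ MulAction.stabilizer (absoluteGaloisGroup ℚ) (adicCompletionPrime ℚ v) := by
    intro σ
    refine ⟨hU σ, ?_⟩
    change _ ∈ (adicCompletionPrime ℚ v).decompositionSubgroup (absoluteGaloisGroup ℚ)
    rw [hrange]
    exact absGaloisRestrictTower_mem_range ℚ (Place.Completion (Sum.inr v)) F σ
  have h0 : resLe (tateRep W p).toIntRep.toTopRep (inf_le_left : cycSubgroup p k r ⊓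
      MulAction.stabilizer (absoluteGaloisGroup ℚ) (adicCompletionPrime ℚ v) ≤ cycSubgroup p k r) 1
      (show continuousCohomology 1 (subgroupRep (tateRep W p).toIntRep.toTopRep (cycSubgroup p k r)) from
        ((tateRep W p).level (cycSubgroup p k r)).H1toInt y) = 0 := by
    refine (H1toInt_resLe (tateRep W p) inf_le_left y).symm.trans ?_
    rw [hy _ (adicCompletionPrime_mem_primesAbove ℚ v)]
    exact map_zero _
  rw [← locTower_resLe ℚ (Place.Completion (Sum.inr v)) F (tateRep W p).toIntRep.toTopRep inf_le_left hst 1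
    _, h0, map_zero]

end Summit.BirchSwinnertonDyer.BirchSwinnertonDyer.Theorems.KimAtThreeFineKatoLevelCompatDef

end
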